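import Literature.NumberTheory.Rogawski1990.ArchWeilDataCongruence          -- ★ p841534 PART 1: torus push, (C′)(C′G)(W) carried
import Literature.NumberTheory.Rogawski1990.ArchInnerTransferCongruence      -- ★ (T-d) FILE 2
import Literature.NumberTheory.Rogawski1990.ArchSmoothCongruence             -- ★ (T-d) FILE 4
import Literature.NumberTheory.Rogawski1990.ArchDeltaTransferCongruence      -- ★ (T-d) FILE 5
import Literature.NumberTheory.Rogawski1990.LocalTransferAdmissibleFamilies  -- ★ `IsAdmissibleOn.transport`
import Literature.NumberTheory.Rogawski1990.ArchCentralValueTransferExists   -- ★ the (S-d) letter `ArchCentralValueTransfer[Exists]`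
import Literature.NumberTheory.Rogawski1990.AdelicStableOrbitalCentralH      -- ★ `coe_coe_cmRationalToArch_eq_smul_one_of_smul_one`
import HarnessLib

/-!
# The (S-d) central-value letter `ArchCentralValueTransfer` is carried by a congruence of the inner form (ROAD-Sd R5 «(T-d) ASSEMBLY», parts 2–3)
(Rogawski (1990), §14.5 p. 239, §14.4 p. 237, §14.2 (14.2.1) p. 232, §1.7 p. 6; Deitmar–Echterhoff (2014), Thm. 1.5.3)

Topic `NumberTheory/Rogawski1990`; namespace `Literature.NumberTheory.Rogawski1990`.  THEOREMS ONLY over accepted tree modules (no definition, no instance, no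
notation, no named fact, no `sorry`).  Cell `hodgecm-mathlib`, crux H413 (`stmt-HodgeConjecture-24833`); LEAD F0P3a-plan (g9) T8-74 (C); F0P3-p03 (g9); census
`F0/P3/F0P3-p03/g9/CENSUS-R5-TdAssembly.F0P3p03g9.md`.  Count-neutral floor-1 plumbing under books row #111 (`stub_Sd`): it lets the registered stub
`stub_SdCanonical` of the pay-down line `F0_P3a_SdArch` (any canonical `H′`) be paid from the SAME letter at a congruent — e.g. DIAGONAL — form.
HC_CM is proved only modulo the printed citations until rung 0 closes.

SETTING — the ABSTRACT FRAME of ★ (T-d) FILES 1–5: `Φ : U(H₂)(L ⊗ ℝ) ≃ₜ* U(H)(L ⊗ ℝ)`, `Φ g = T g T⁻¹`; the letter is WANTED on the SOURCE `H₂` and KNOWN on the TARGET `H`.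
Given a thirteen-conjunct system `(m₂, m, m_H, t₂, t, t_H)` on `(U(H₂), U(Φ₃), H_∞)` we PUSH it to `(Φ_* m₂, m, m_H, t^Φ, t, t_H)` on `(U(H), U(Φ₃), H_∞)`:
admissibility (★ `IsAdmissibleOn.transport`), non-degeneracy and Δ-transfer existence for the pushed factor `T₂^Φ := T₂.comap Φ⁻¹` (★ FILE 5; the pull-back
`(T₂^Φ).comap Φ = T₂` is the one-field extensionality of ★ `TransferFactorData`), inner-transfer existence (★ FILE 2 + ★ FILE 4), the Weil form (W′) and the
coherences (C′)(C′G) (★ PART 1 `ArchWeilDataCongruence`); (W)(W_H)(C)(C_H) do not move.  The KNOWN letter on `H` applied to the pushed system and to the pair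
`(a₂ ∘ Φ⁻¹, a)` at the rational scalar `ζ•1` gives `a(γ_∞) = a₂(Φ⁻¹(ζ•1 ⊗ 1)) = a₂((γ₀)_∞)` — `Φ⁻¹` fixes scalars.

* §1 `TransferFactorData.comap_symm_comap` (factor round trip) · `exists_rational_smul_one_of_smul_one` (a rational scalar of `U(Φ₃)(L)` gives one of every `U(H)(L)`) ·
  `archCongr_symm_cmRationalToArch_of_smul_one` (`Φ⁻¹` fixes the archimedean image of a rational scalar).
* §2 **`archCentralValueTransfer_of_archCongr`** — `ArchCentralValueTransfer L H T₂^Φ (Φ_* ν₂) ν ν_H → ArchCentralValueTransfer L H₂ T₂ ν₂ ν ν_H` (the target's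
  guards `hherm`, `hanis`, `hS₀` supplied by the caller — for a RATIONAL congruence they follow from the source's), and the `∃ν` shape
  **`archCentralValueTransferExists_of_archCongr`**.

## References
* [Rogawski1990] J. D. Rogawski, *Automorphic Representations of Unitary Groups in Three Variables*, Ann. of Math. Stud. 123 (1990), §14.5 p. 239, §14.4 p. 237,
  §14.2 (14.2.1) p. 232, §4.3 (4.3.1) p. 43, §1.7 p. 6.
* [DeitmarEchterhoff2014] A. Deitmar, S. Echterhoff, *Principles of Harmonic Analysis*, 2nd ed. (2014), Thm. 1.5.3.
* [PlatonovRapinchuk1994] V. Platonov, A. Rapinchuk, *Algebraic Groups and Number Theory* (1994), §2.3.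
-/

set_option autoImplicit false

noncomputable section

open MeasureTheory Measure NumberField NumberField.InfinitePlace NumberField.mixedEmbedding IsDedekindDomain
open Literature.MeasureTheory.Group

namespace Literature.NumberTheory.Rogawski1990

open Literature.NumberTheory.Automorphic Literature.NumberTheory.GaloisRepresentations
open Literature.AlgebraicGeometry.ShimuraVarieties (unitaryGroup hermForm)
open scoped Matrix ComplexOrder MatrixGroups

/-! ## §1 Small bookkeeping: factor round trip, rational scalars -/

section Bookkeeping

/-- **Factor round trip**: pulling back along `ψ` the factor pushed along `ψ⁻¹` returns the factor (★ `TransferFactorData` has ONE data field `Δ`).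
[cite: Rogawski1990, §14.4 p. 237] -/
theorem TransferFactorData.comap_symm_comap {Hs A B : Type*} [Group Hs] [Group A] [Group B] {R : Hs → B → Prop} {R' : Hs → A → Prop}
    (TΔ : TransferFactorData Hs B R) (ψ : B ≃* A) (h₁ : ∀ h a, R h (ψ.symm a) → R' h a) (h₂ : ∀ h b, R' h (ψ b) → R h b) :
    (TΔ.comap ψ.symm h₁).comap ψ h₂ = TΔ := by
  cases TΔ with
  | mk Δ h0 hl hr =>
    simp only [TransferFactorData.comap]
    congr 1
    funext h b
    exact congrArg (Δ h) (ψ.symm_apply_apply b)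

variable (L : Type) [Field L] [NumberField L] [IsCMField L]

/-- **A rational scalar of `U(Φ₃)(L)` is a rational scalar of every `U(H)(L)`**: if `γ ∈ U(Φ₃)(L)` has matrix `ζ • 1` then `c(ζ) ζ = 1`, so `ζ • 1 ∈ U(H)(L)` for any
`H ∈ M₃(L)`. [cite: Rogawski1990, §14.5 p. 239; §3.1 p. 19] -/
theorem exists_rational_smul_one_of_smul_one (H : Matrix (Fin 3) (Fin 3) L)
    (γ : (UnitaryGroup.cmDatum L 3 (Matrix.of fun i j : Fin 3 => if i.val + j.val + 1 = 3 then (1 : L) else 0)).Rational) (ζ : L)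
    (hγ : (((γ : unitaryGroup (cmConjRingHom L) (Matrix.of fun i j : Fin 3 => if i.val + j.val + 1 = 3 then (1 : L) else 0)).val : GL (Fin 3) L) : Matrix (Fin 3) (Fin 3) L) = ζ • (1 : Matrix (Fin 3) (Fin 3) L)) :
    ∃ γ₀ : (UnitaryGroup.cmDatum L 3 H).Rational,
      (((γ₀ : unitaryGroup (cmConjRingHom L) H).val : GL (Fin 3) L) : Matrix (Fin 3) (Fin 3) L) = ζ • (1 : Matrix (Fin 3) (Fin 3) L) := by
  -- `c(ζ) ζ = 1` from the membership of `γ` in `U(Φ₃)(L)` read at the entry `(0, 2)`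
  have hmem := (Literature.AlgebraicGeometry.ShimuraVarieties.mem_unitaryGroup_iff.1 (γ : unitaryGroup (cmConjRingHom L) (Matrix.of fun i j : Fin 3 => if i.val + j.val + 1 = 3 then (1 : L) else 0)).2)
  rw [hγ] at hmem
  have hmap : ((ζ • (1 : Matrix (Fin 3) (Fin 3) L)).map (cmConjRingHom L)) = cmConjRingHom L ζ • (1 : Matrix (Fin 3) (Fin 3) L) := by
    rw [Matrix.smul_one_eq_diagonal, Matrix.diagonal_map (map_zero _), Matrix.smul_one_eq_diagonal]
  rw [hmap, Matrix.transpose_smul, Matrix.transpose_one, Matrix.smul_mul, Matrix.one_mul, Matrix.mul_smul, Matrix.mul_one, smul_smul] at hmem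
  have h02 := congrFun (congrFun hmem 0) 2
  simp only [Matrix.smul_apply, Matrix.of_apply, smul_eq_mul] at h02
  norm_num at h02
  -- so `ζ` is a unit of norm one and `ζ • 1 ∈ U(H)(L)`
  have hζ : ζ ≠ 0 := by
    rintro rfl
    simp at h02
  refine ⟨⟨Units.map (Matrix.scalar (Fin 3) : L →+* Matrix (Fin 3) (Fin 3) L).toMonoidHom (Units.mk0 ζ hζ), ?_⟩, ?_⟩
  · have h := scalar_mem_unitaryGroupOfForm (cmConjRingHom L) H (Units.mk0 ζ hζ) (by simpa [mul_comm] using h02)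
    exact Literature.AlgebraicGeometry.ShimuraVarieties.mem_unitaryGroup_iff.2 (mem_unitaryGroupOfForm_iff.1 h)
  · show ((Matrix.scalar (Fin 3) : L →+* Matrix (Fin 3) (Fin 3) L) ζ) = ζ • (1 : Matrix (Fin 3) (Fin 3) L)
    rw [Matrix.scalar_apply, Matrix.smul_one_eq_diagonal]

variable {H H₂ : Matrix (Fin 3) (Fin 3) L} (T : GL (Fin 3) (mixedSpace L))
  (Φ : UnitaryGroup.arch (↥(maximalRealSubfield L)) L (IsCMField.complexConj L) 3 H₂ ≃ₜ* UnitaryGroup.arch (↥(maximalRealSubfield L)) L (IsCMField.complexConj L) 3 H)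
  (hΦ : ∀ g : UnitaryGroup.arch (↥(maximalRealSubfield L)) L (IsCMField.complexConj L) 3 H₂, ((Φ g : UnitaryGroup.arch (↥(maximalRealSubfield L)) L (IsCMField.complexConj L) 3 H) : GL (Fin 3) (mixedSpace L)) = T * (g : GL (Fin 3) (mixedSpace L)) * T⁻¹)

include hΦ in
/-- **`Φ⁻¹` fixes the archimedean image of a rational scalar**: for `γ₀ ∈ U(H₂)(L)`, `γ₀' ∈ U(H)(L)` both with matrix `ζ • 1`,
`Φ⁻¹ (γ₀' ⊗ 1) = γ₀ ⊗ 1` (both are the central `ζ ⊗ 1`, and `Φ⁻¹ y = T⁻¹ y T`). [cite: Rogawski1990, §14.5 p. 239; §3.1 p. 19] -/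
theorem archCongr_symm_cmRationalToArch_of_smul_one (γ₀ : (UnitaryGroup.cmDatum L 3 H₂).Rational) (γ₀' : (UnitaryGroup.cmDatum L 3 H).Rational) (ζ : L)
    (hγ₀ : (((γ₀ : unitaryGroup (cmConjRingHom L) H₂).val : GL (Fin 3) L) : Matrix (Fin 3) (Fin 3) L) = ζ • (1 : Matrix (Fin 3) (Fin 3) L))
    (hγ₀' : (((γ₀' : unitaryGroup (cmConjRingHom L) H).val : GL (Fin 3) L) : Matrix (Fin 3) (Fin 3) L) = ζ • (1 : Matrix (Fin 3) (Fin 3) L)) :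
    Φ.symm (cmRationalToArch L 3 H γ₀') = cmRationalToArch L 3 H₂ γ₀ := by
  apply Subtype.ext
  apply Units.ext
  have h1 : (((Φ.symm (cmRationalToArch L 3 H γ₀') : UnitaryGroup.arch (↥(maximalRealSubfield L)) L (IsCMField.complexConj L) 3 H₂) : GL (Fin 3) (mixedSpace L)) : Matrix (Fin 3) (Fin 3) (mixedSpace L)) =
      (T⁻¹ : GL (Fin 3) (mixedSpace L)).val * (mixedEmbedding L ζ • (1 : Matrix (Fin 3) (Fin 3) (mixedSpace L))) * (T : GL (Fin 3) (mixedSpace L)).val := by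
    rw [coe_archCongr_symm_apply L T Φ hΦ, Units.val_mul, Units.val_mul, coe_coe_cmRationalToArch_eq_smul_one_of_smul_one hγ₀']
  rw [h1, coe_coe_cmRationalToArch_eq_smul_one_of_smul_one hγ₀, Matrix.mul_smul, Matrix.mul_one, Matrix.smul_mul, ← Units.val_mul, inv_mul_cancel,
    Units.val_one]

end Bookkeeping

/-! ## §2 The letter along `Φ` -/

section Letter

variable (L : Type) [Field L] [NumberField L] [IsCMField L] {H H₂ : Matrix (Fin 3) (Fin 3) L} (T : GL (Fin 3) (mixedSpace L))
  (Φ : UnitaryGroup.arch (↥(maximalRealSubfield L)) L (IsCMField.complexConj L) 3 H₂ ≃ₜ* UnitaryGroup.arch (↥(maximalRealSubfield L)) L (IsCMField.complexConj L) 3 H)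
  (hΦ : ∀ g : UnitaryGroup.arch (↥(maximalRealSubfield L)) L (IsCMField.complexConj L) 3 H₂, ((Φ g : UnitaryGroup.arch (↥(maximalRealSubfield L)) L (IsCMField.complexConj L) 3 H) : GL (Fin 3) (mixedSpace L)) = T * (g : GL (Fin 3) (mixedSpace L)) * T⁻¹)
  [MeasurableSpace (UnitaryGroup.arch (↥(maximalRealSubfield L)) L (IsCMField.complexConj L) 3 H₂)] [BorelSpace (UnitaryGroup.arch (↥(maximalRealSubfield L)) L (IsCMField.complexConj L) 3 H₂)]
  [MeasurableSpace (UnitaryGroup.arch (↥(maximalRealSubfield L)) L (IsCMField.complexConj L) 3 H)] [BorelSpace (UnitaryGroup.arch (↥(maximalRealSubfield L)) L (IsCMField.complexConj L) 3 H)]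
  [MeasurableSpace (UnitaryGroup.arch (↥(maximalRealSubfield L)) L (IsCMField.complexConj L) 3 (Matrix.of fun i j : Fin 3 => if i.val + j.val + 1 = 3 then (1 : L) else 0))] [BorelSpace (UnitaryGroup.arch (↥(maximalRealSubfield L)) L (IsCMField.complexConj L) 3 (Matrix.of fun i j : Fin 3 => if i.val + j.val + 1 = 3 then (1 : L) else 0))]
  [MeasurableSpace (UnitaryGroup.arch (↥(maximalRealSubfield L)) L (IsCMField.complexConj L) 2 (Matrix.of fun i j : Fin 2 => if i.val + j.val + 1 = 2 then (1 : L) else 0) × UnitaryGroup.arch (↥(maximalRealSubfield L)) L (IsCMField.complexConj L) 1 (Matrix.of fun i j : Fin 1 => if i.val + j.val + 1 = 1 then (1 : L) else 0))] [BorelSpace (UnitaryGroup.arch (↥(maximalRealSubfield L)) L (IsCMField.complexConj L) 2 (Matrix.of fun i j : Fin 2 => if i.val + j.val + 1 = 2 then (1 : L) else 0) × UnitaryGroup.arch (↥(maximalRealSubfield L)) L (IsCMField.complexConj L) 1 (Matrix.of fun i j : Fin 1 => if i.val + j.val + 1 = 1 then (1 : L) else 0))]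
  (T₂ : ArchTransferFactor L H₂)
  (ν₂ : Measure (UnitaryGroup.arch (↥(maximalRealSubfield L)) L (IsCMField.complexConj L) 3 H₂)) [ν₂.IsHaarMeasure] [ν₂.IsMulRightInvariant]
  (νt : Measure (UnitaryGroup.arch (↥(maximalRealSubfield L)) L (IsCMField.complexConj L) 3 H)) [νt.IsHaarMeasure] [νt.IsMulRightInvariant] (hνt : νt = ν₂.map Φ)
  (ν : Measure (UnitaryGroup.arch (↥(maximalRealSubfield L)) L (IsCMField.complexConj L) 3 (Matrix.of fun i j : Fin 3 => if i.val + j.val + 1 = 3 then (1 : L) else 0))) [IsFiniteMeasureOnCompacts ν] [ν.IsMulRightInvariant]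
  (νH : Measure (UnitaryGroup.arch (↥(maximalRealSubfield L)) L (IsCMField.complexConj L) 2 (Matrix.of fun i j : Fin 2 => if i.val + j.val + 1 = 2 then (1 : L) else 0) × UnitaryGroup.arch (↥(maximalRealSubfield L)) L (IsCMField.complexConj L) 1 (Matrix.of fun i j : Fin 1 => if i.val + j.val + 1 = 1 then (1 : L) else 0))) [IsFiniteMeasureOnCompacts νH] [νH.IsMulRightInvariant]

set_option maxHeartbeats 800000 in
include hΦ hνt in
/-- **(S-d) IS CARRIED BY A CONGRUENCE OF THE INNER FORM.**  If the central-value letter holds on `U(H)` for the pushed factor `T₂^Φ = T₂.comap Φ⁻¹` and the pushed Haar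
measure `Φ_* ν₂` (with the SAME `ν` on `U(Φ₃)(L ⊗ ℝ)` and `ν_H` on `H_∞`), then it holds on `U(H₂)` for `(T₂, ν₂)`.  The target's guards (hermitian, anisotropic,
a definite place) are the caller's (for a rational congruence `H = ᵗP̄ H₂ P` they follow from the source's). [cite: Rogawski1990, §14.5 p. 239; §14.4 p. 237; §1.7 p. 6]
[cite: DeitmarEchterhoff2014, Thm. 1.5.3] -/
theorem archCentralValueTransfer_of_archCongr
    (hhermH : (H.map (cmConjRingHom L)).transpose = H) (hanisH : ∀ x : Fin 3 → L, hermForm (cmConjRingHom L) H x x = 0 → x = 0)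
    (hS₀H : ∃ w : {w : InfinitePlace L // IsComplex w}, (H.map w.1.embedding).PosDef ∨ (-H.map w.1.embedding).PosDef)
    (h : ArchCentralValueTransfer L H
      (T₂.comap Φ.symm.toMulEquiv (fun γH b hb => (isArchNormPair_archCongr_symm_iff L T Φ hΦ γH b).1 hb)) νt ν νH) :
    ArchCentralValueTransfer L H₂ T₂ ν₂ ν νH := by
  intro hherm₂ hanis₂ hS₀₂ iGpm iGpb iGm iGb iHm iHb m₂ m mH t₂ t tH hbody a₂ a ha₂ ha hIT γ₀ γ ζ hγ₀ hγ
  obtain ⟨hadm₂, hadm, hadmH, hnd, hITE, hDTE, hW₂, hW, hWH, hC₂, hC, hCG, hCH⟩ := hbody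
  -- σ-algebras on the target quotients: Borel
  letI iTm : ∀ δ : UnitaryGroup.arch (↥(maximalRealSubfield L)) L (IsCMField.complexConj L) 3 H, MeasurableSpace (UnitaryGroup.arch (↥(maximalRealSubfield L)) L (IsCMField.complexConj L) 3 H ⧸ Subgroup.centralizer ({δ} : Set (UnitaryGroup.arch (↥(maximalRealSubfield L)) L (IsCMField.complexConj L) 3 H))) := fun _ => borel _
  haveI iTb : ∀ δ : UnitaryGroup.arch (↥(maximalRealSubfield L)) L (IsCMField.complexConj L) 3 H, BorelSpace (UnitaryGroup.arch (↥(maximalRealSubfield L)) L (IsCMField.complexConj L) 3 H ⧸ Subgroup.centralizer ({δ} : Set (UnitaryGroup.arch (↥(maximalRealSubfield L)) L (IsCMField.complexConj L) 3 H))) := fun _ => ⟨rfl⟩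
  -- the pushed torus datum (★ PART 1's lambda) and its defining equation
  obtain ⟨tp, htp⟩ := UnitaryGroup.exists_torusPush_archCongr L Φ t₂
  -- the factor round trip
  have hTT : (T₂.comap Φ.symm.toMulEquiv (fun γH b hb => (isArchNormPair_archCongr_symm_iff L T Φ hΦ γH b).1 hb)).comap Φ.toMulEquiv
      (isArchNormPair_of_archCongr L T Φ hΦ) = T₂ :=
    TransferFactorData.comap_symm_comap T₂ Φ.toMulEquiv _ _
  -- regularity is a class function and is carried by `Φ`
  have hQ : ∀ b b' : UnitaryGroup.arch (↥(maximalRealSubfield L)) L (IsCMField.complexConj L) 3 H₂, IsConj b b' →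
      (IsRegularElt (b.val : GL (Fin 3) (mixedSpace L)) ↔ IsRegularElt (b'.val : GL (Fin 3) (mixedSpace L))) := fun b b' hbb' =>
    ⟨fun hb => isRegularElt_of_isConj ((UnitaryGroup.arch (↥(maximalRealSubfield L)) L (IsCMField.complexConj L) 3 H₂).subtype.map_isConj hbb') hb,
      fun hb' => isRegularElt_of_isConj ((UnitaryGroup.arch (↥(maximalRealSubfield L)) L (IsCMField.complexConj L) 3 H₂).subtype.map_isConj hbb'.symm) hb'⟩
  have hPQ : ∀ δ : UnitaryGroup.arch (↥(maximalRealSubfield L)) L (IsCMField.complexConj L) 3 H, IsRegularElt (δ.val : GL (Fin 3) (mixedSpace L)) →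
      IsRegularElt ((Φ.toMulEquiv.symm δ).val : GL (Fin 3) (mixedSpace L)) := fun δ hδ =>
    (isRegularElt_coe_archCongr_iff L T Φ hΦ (Φ.symm δ)).1 (by rwa [ContinuousMulEquiv.apply_symm_apply])
  -- the scalar on the target
  obtain ⟨γ₀H, hγ₀H⟩ := exists_rational_smul_one_of_smul_one L H γ ζ hγ
  rw [show a₂ (cmRationalToArch L 3 H₂ γ₀) = (a₂ ∘ Φ.symm) (cmRationalToArch L 3 H γ₀H) from by
    rw [Function.comp_apply, archCongr_symm_cmRationalToArch_of_smul_one L T Φ hΦ γ₀ γ₀H ζ hγ₀ hγ₀H]]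
  -- THE LETTER ON THE TARGET, at the pushed system and the pair `(a₂ ∘ Φ⁻¹, a)`
  refine h hhermH hanisH hS₀H (iGpm := iTm) (iGpb := iTb) (iGm := iGm) (iGb := iGb) (iHm := iHm) (iHb := iHb)
    (m₂.transport Φ.toMulEquiv Φ.continuous Φ.symm.continuous) m mH tp t tH
    ⟨?_, hadm, hadmH, ?_, ?_, ?_, ?_, hW, hWH, ?_, hC, ?_, hCH⟩
    (a₂ ∘ Φ.symm) a (ha₂.comp_archCongr_symm L T Φ hΦ) ha ((isArchInnerTransfer_transport_left_iff L T Φ hΦ m₂ m a₂ a).2 hIT) γ₀H γ ζ hγ₀H hγ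
  · -- (i) admissibility of `Φ_* m₂` on the regular classes
    exact hadm₂.transport Φ.toMulEquiv Φ.continuous Φ.symm.continuous hQ hPQ
  · -- (iv) non-degeneracy of the pushed factor
    refine (isArchNondegenerate_comap_iff L T Φ hΦ _).1 ?_
    rw [hTT]
    exact hnd
  · -- (v) inner-transfer existence
    intro a' ha'
    obtain ⟨a₀, ha₀, hrel⟩ := hITE (a' ∘ Φ) (ha'.comp_archCongr L T Φ hΦ)
    refine ⟨a₀, ha₀, ?_⟩
    have hcomp : (a' ∘ Φ) ∘ Φ.symm = a' := funext fun x => by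
      show a' (Φ (Φ.symm x)) = a' x
      rw [ContinuousMulEquiv.apply_symm_apply]
    rw [← hcomp]
    exact (isArchInnerTransfer_transport_left_iff L T Φ hΦ m₂ m (a' ∘ Φ) a₀).2 hrel
  · -- (vi) Δ-transfer existence for the pushed factor
    intro a' ha'
    obtain ⟨aH, haH, hrel⟩ := hDTE (a' ∘ Φ) (ha'.comp_archCongr L T Φ hΦ)
    refine ⟨aH, haH, ?_⟩
    have hcomp : (a' ∘ Φ) ∘ Φ.symm = a' := funext fun x => by
      show a' (Φ (Φ.symm x)) = a' x
      rw [ContinuousMulEquiv.apply_symm_apply]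
    have h5 := (isArchDeltaTransfer_comap_iff L T Φ hΦ
      (T₂.comap Φ.symm.toMulEquiv (fun γH b hb => (isArchNormPair_archCongr_symm_iff L T Φ hΦ γH b).1 hb)) mH m₂ aH (a' ∘ Φ)).1
    rw [hTT, hcomp] at h5
    exact h5 hrel
  · -- (W′) the Weil form of `Φ_* m₂` w.r.t. the pushed torus datum
    exact UnitaryGroup.isQuotientOf_transport_archCongr L (Godement.det_ne_zero_of_anisotropic L H₂ hanis₂) T Φ hΦ t₂ tp htp hW₂ hC₂ νt hνt
  · -- (C′) carried
    exact fun δ₁ δ₂ h₁ hc => UnitaryGroup.map_archStableCentralizerEquiv_torusPush_eq L (Godement.det_ne_zero_of_anisotropic L H hanisH)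
      (Godement.det_ne_zero_of_anisotropic L H₂ hanis₂) T Φ hΦ t₂ tp htp hC₂ δ₁ δ₂ h₁ hc
  · -- (C′G) carried
    exact fun δ γ' h' hc => UnitaryGroup.map_archStableCentralizerEquiv_torusPush_eq_of_cross L (Godement.det_ne_zero_of_anisotropic L H hanisH)
      (Godement.det_ne_zero_of_anisotropic L H₂ hanis₂) (UnitaryGroup.isUnit_antidiagOne_det L 3).ne_zero T Φ hΦ t₂ tp htp t hCG δ γ' h' hc

include hΦ hνt in
/-- **The `∃ν` shape is carried too**: `ArchCentralValueTransferExists L H T₂^Φ (Φ_* ν₂) ν_H → ArchCentralValueTransferExists L H₂ T₂ ν₂ ν_H` (the SAME Haar measure `ν` on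
`U(Φ₃)(L ⊗ ℝ)` serves). [cite: Rogawski1990, §14.5 p. 239; §1.7 p. 6] -/
theorem archCentralValueTransferExists_of_archCongr
    (hhermH : (H.map (cmConjRingHom L)).transpose = H) (hanisH : ∀ x : Fin 3 → L, hermForm (cmConjRingHom L) H x x = 0 → x = 0)
    (hS₀H : ∃ w : {w : InfinitePlace L // IsComplex w}, (H.map w.1.embedding).PosDef ∨ (-H.map w.1.embedding).PosDef)
    (h : ArchCentralValueTransferExists L H
      (T₂.comap Φ.symm.toMulEquiv (fun γH b hb => (isArchNormPair_archCongr_symm_iff L T Φ hΦ γH b).1 hb)) νt νH) :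
    ArchCentralValueTransferExists L H₂ T₂ ν₂ νH := by
  obtain ⟨ν', hν'1, hν'2, hcv⟩ := h
  exact ⟨ν', hν'1, hν'2, archCentralValueTransfer_of_archCongr L T Φ hΦ T₂ ν₂ νt hνt ν' νH hhermH hanisH hS₀H hcv⟩

end Letter

end Literature.NumberTheory.Rogawski1990

end
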